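import Literature.NumberTheory.Sieve.LevelOfDistribution
import Literature.NumberTheory.LFunctions.SiegelWalfisz
import Literature.NumberTheory.LFunctions.ChebyshevPsiLogPowerError
import Literature.NumberTheory.LFunctions.PagePNTWithExceptionalZeroProofs
import Literature.NumberTheory.Sieve.BombieriFriedlanderIwaniecDyadic
import Mathlib.NumberTheory.ArithmeticFunction.VonMangoldt
import Mathlib.NumberTheory.Chebyshev
import HarnessLib

/-!
# `Λ` on an interval as a coefficient sequence for `GEH[ϑ]` — elementary bookkeeping

Trunk AntSieve, tooling toward the named fact `Literature.NumberTheory.Sieve.weakDHL_three_two_of_GEH`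
(D. H. J. Polymath, *Variants of the Selberg sieve, and bounded intervals containing many primes*,
Res. Math. Sci. 1:12 (2014) = arXiv:1407.4897, Theorem 3.2(xii)).  In the printed deduction the
generalized Elliott–Halberstam hypothesis `GEH[ϑ]` (Claim 2.6, the tree's
`GeneralizedElliottHalberstam ϑ`) is always applied with `β` a piece of the von Mangoldt function (or of
the primes) on a short interval: Proposition 2.7 (`GEH ⟹ EH`, Vaughan's identity, p. 7) and §4.5
(p. 17).  Claim 2.6 asks of `β` the Siegel–Walfisz property (2.4):
`|Δ(β 1_{(·,r)=1}; a (q))| ≪ τ(qr)^{O(1)} M log^{-A} x` for ALL `q, r ≥ 1`.  This file sets up the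
pieces and the elementary part of that verification:

* `vonMangoldtPiece m m'` — `Λ · 1_{(m, m']}` as an `ArithmeticFunction ℝ` (natural endpoints; real
  endpoints reduce to these by taking floors);
* `sum_filter_vonMangoldtPiece_modEq` — `Σ_{n ≤ N, n ≡ a (q)} (Λ 1_{(m,m']})(n) = ψ(m'; q, a) − ψ(m; q, a)`
  for `N ≥ m'` (`ψ(·; q, a) = LevelOfDistribution.chebyshevPsiMod`);
* `sum_vonMangoldt_filter_dvd_le_log` — `Σ_{n ≤ y, p ∣ n} Λ(n) ≤ log y` (the `n` are powers of `p`,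
  all dividing `p^{⌊log_p y⌋}`, and `Σ_{d ∣ p^J} Λ(d) = log p^J`), whence
  `sum_vonMangoldt_filter_not_coprime_le` — `Σ_{n ≤ y, (n,r) > 1} Λ(n) ≤ ω(r) log y`: removing the
  coprimality conditions `(n, r) = 1`, `(n, q) = 1` from sums of `Λ` over an interval costs
  `O(ω(r) log x)`, `O(ω(q) log x)` (p. 14: "since `θ` only differs from `Λ` on powers `p^j` … it is not
  difficult to show …"; here the analogous bookkeeping for the coprimality filters of (2.4)).

The analytic inputs (Siegel–Walfisz, the prime number theorem with error term) enter in the sequel.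

## References

* [Polymath8b2014] D. H. J. Polymath, Res. Math. Sci. 1 (2014), Art. 12 = arXiv:1407.4897,
  Claim 2.6 (2.4) (p. 6), Proposition 2.7 (p. 7), §4.2 (p. 14), §4.5 (p. 17).
-/

noncomputable section

open Finset Real
open scoped ArithmeticFunction.vonMangoldt ArithmeticFunction.omega ArithmeticFunction.sigma

namespace Literature.NumberTheory.Sieve

/-! ### The piece `Λ · 1_{(m, m']}` -/

/-- `Λ · 1_{(m, m']}`: the von Mangoldt function restricted to an interval with natural endpoints, as an
arithmetic function (the `β` of Claim 2.6 in Proposition 2.7). [cite: Polymath8b2014, Proposition 2.7] -/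
def vonMangoldtPiece (m m' : ℕ) : ArithmeticFunction ℝ :=
  ⟨fun n => if m < n ∧ n ≤ m' then Λ n else 0, by simp⟩

/-- Values of the piece. [folklore] -/
theorem vonMangoldtPiece_apply (m m' n : ℕ) :
    vonMangoldtPiece m m' n = if m < n ∧ n ≤ m' then Λ n else 0 := rfl

/-- The piece is nonnegative. [folklore] -/
theorem vonMangoldtPiece_nonneg (m m' n : ℕ) : 0 ≤ vonMangoldtPiece m m' n := by
  rw [vonMangoldtPiece_apply]
  split_ifs
  · exact ArithmeticFunction.vonMangoldt_nonneg
  · exact le_rfl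

/-- The piece is bounded by `Λ`. [folklore] -/
theorem vonMangoldtPiece_le (m m' n : ℕ) : vonMangoldtPiece m m' n ≤ Λ n := by
  rw [vonMangoldtPiece_apply]
  split_ifs
  · exact le_rfl
  · exact ArithmeticFunction.vonMangoldt_nonneg

/-- The piece vanishes off `(m, m']`. [folklore] -/
theorem vonMangoldtPiece_eq_zero {m m' n : ℕ} (h : n ≤ m ∨ m' < n) : vonMangoldtPiece m m' n = 0 := by
  rw [vonMangoldtPiece_apply, if_neg]
  rintro ⟨h1, h2⟩
  rcases h with h | h <;> omega

/-- **Restricting a filtered sum of the piece to its interval**: for `N ≥ m'` and any predicate `p`,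
`Σ_{n ∈ [1,N], p n} (Λ 1_{(m,m']})(n) = Σ_{n ∈ (m, m'], p n} Λ(n)`. [folklore] -/
theorem sum_filter_vonMangoldtPiece {m m' N : ℕ} (hN : m' ≤ N) (p : ℕ → Prop) [DecidablePred p] :
    ∑ n ∈ (Icc 1 N).filter p, vonMangoldtPiece m m' n = ∑ n ∈ (Ioc m m').filter p, Λ n := by
  have hsub : (Ioc m m').filter p ⊆ (Icc 1 N).filter p := by
    refine Finset.filter_subset_filter p fun n hn => ?_
    rw [Finset.mem_Ioc] at hn
    rw [Finset.mem_Icc]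
    omega
  rw [← Finset.sum_subset hsub]
  · refine Finset.sum_congr rfl fun n hn => ?_
    have hn' := (Finset.mem_filter.1 hn).1
    rw [Finset.mem_Ioc] at hn'
    rw [vonMangoldtPiece_apply, if_pos ⟨hn'.1, hn'.2⟩]
  · intro n hn hn'
    have hp : p n := (Finset.mem_filter.1 hn).2
    have hnot : n ∉ Ioc m m' := fun h => hn' (Finset.mem_filter.2 ⟨h, hp⟩)
    rw [Finset.mem_Ioc, not_and_or, not_lt, not_le] at hnot
    exact vonMangoldtPiece_eq_zero hnot

/-- `ψ(m'; q, a) − ψ(m; q, a) = Σ_{m < n ≤ m', n ≡ a (q)} Λ(n)` for natural `m ≤ m'`. [folklore] -/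
theorem chebyshevPsiMod_natCast_sub {q : ℕ} (a : ZMod q) {m m' : ℕ} (h : m ≤ m') :
    LevelOfDistribution.chebyshevPsiMod q a m' - LevelOfDistribution.chebyshevPsiMod q a m =
      ∑ n ∈ (Ioc m m').filter fun n : ℕ => (n : ZMod q) = a, Λ n := by
  unfold LevelOfDistribution.chebyshevPsiMod
  rw [Nat.floor_natCast, Nat.floor_natCast, Finset.range_eq_Ico, Finset.range_eq_Ico,
    ← Finset.sum_Ico_consecutive _ (Nat.zero_le (m + 1)) (by omega : m + 1 ≤ m' + 1), add_sub_cancel_left,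
    Finset.sum_filter]
  have : Finset.Ico (m + 1) (m' + 1) = Finset.Ioc m m' := by
    ext n; simp only [Finset.mem_Ico, Finset.mem_Ioc]; omega
  rw [this]
  refine Finset.sum_congr rfl fun n _ => ?_
  simp only [ArithmeticFunction.vonMangoldt.residueClass, Set.indicator_apply, Set.mem_setOf_eq]

/-- **The progression sum of a piece is a difference of `ψ(·; q, a)`**: for `N ≥ m' ≥ m`,
`Σ_{n ≤ N, n ≡ a (q)} (Λ 1_{(m,m']})(n) = ψ(m'; q, a) − ψ(m; q, a)`. [cite: Polymath8b2014, Proposition 2.7] -/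
theorem sum_filter_vonMangoldtPiece_modEq {q : ℕ} (a : ZMod q) {m m' N : ℕ} (h : m ≤ m') (hN : m' ≤ N) :
    ∑ n ∈ (Icc 1 N).filter (fun n : ℕ => (n : ZMod q) = a), vonMangoldtPiece m m' n =
      LevelOfDistribution.chebyshevPsiMod q a m' - LevelOfDistribution.chebyshevPsiMod q a m := by
  rw [sum_filter_vonMangoldtPiece hN, chebyshevPsiMod_natCast_sub a h]

/-! ### Removing coprimality conditions from sums of `Λ` -/

/-- **`Σ_{n ≤ y, p ∣ n} Λ(n) ≤ log y`** for a prime `p` and `y ≥ 1`: the `n` with `p ∣ n` and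
`Λ(n) ≠ 0` are powers `p^i ≤ y`, all dividing `p^J`, `J = ⌊log_p y⌋`, and `Σ_{d ∣ p^J} Λ(d) = log p^J ≤ log y`.
[folklore] -/
theorem sum_vonMangoldt_filter_dvd_le_log {p y : ℕ} (hp : p.Prime) (hy : 1 ≤ y) :
    ∑ n ∈ (Icc 1 y).filter (fun n => p ∣ n), Λ n ≤ Real.log y := by
  set J := Nat.log p y with hJ
  -- drop the terms with `Λ n = 0`, then compare with the divisor sum of `p^J`
  have key : ∑ n ∈ (Icc 1 y).filter (fun n => p ∣ n), Λ n ≤ ∑ d ∈ (p ^ J).divisors, Λ d := by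
    rw [← Finset.sum_filter_ne_zero ((Icc 1 y).filter fun n => p ∣ n)]
    refine Finset.sum_le_sum_of_subset_of_nonneg ?_ fun _ _ _ => ArithmeticFunction.vonMangoldt_nonneg
    intro n hn
    simp only [Finset.mem_filter, Finset.mem_Icc] at hn
    obtain ⟨⟨⟨hn1, hny⟩, hpn⟩, hΛ⟩ := hn
    rw [Nat.mem_divisors]
    refine ⟨?_, pow_ne_zero _ hp.ne_zero⟩
    -- `n` is a prime power `r^i`, and `p ∣ n` forces `r = p`
    obtain ⟨r, i, hr, hi, rfl⟩ := (isPrimePow_nat_iff _).1 (ArithmeticFunction.vonMangoldt_ne_zero_iff.1 hΛ)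
    have hrp : r = p := by
      have := (Nat.prime_dvd_prime_iff_eq hp hr).1 (hp.dvd_of_dvd_pow hpn)
      exact this.symm
    subst hrp
    refine pow_dvd_pow r ?_
    -- `r^i ≤ y` gives `i ≤ log_r y`
    rw [hJ]
    exact Nat.le_log_of_pow_le hr.one_lt hny
  refine key.trans ?_
  rw [ArithmeticFunction.vonMangoldt_sum]
  have hpow : ((p ^ J : ℕ) : ℝ) ≤ y := by exact_mod_cast Nat.pow_log_le_self p (by omega)
  have hpos : (0 : ℝ) < ((p ^ J : ℕ) : ℝ) := by
    have := pow_pos hp.pos J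
    exact_mod_cast this
  exact Real.log_le_log hpos hpow

/-- **Removing a coprimality condition costs `ω(r) log y`**:
`Σ_{n ≤ y, (n, r) > 1} Λ(n) ≤ ω(r) log y` (`r ≥ 1`, `y ≥ 1`). [cite: Polymath8b2014, §4.2, p. 14] -/
theorem sum_vonMangoldt_filter_not_coprime_le {r y : ℕ} (hr : 1 ≤ r) (hy : 1 ≤ y) :
    ∑ n ∈ (Icc 1 y).filter (fun n => ¬ n.Coprime r), Λ n ≤ (ω r : ℝ) * Real.log y := by
  set S := (Icc 1 y).filter (fun n => ¬ n.Coprime r) with hS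
  -- every `n ∈ S` has a prime factor in common with `r`
  have hex : ∀ n ∈ S, ∃ p ∈ r.primeFactors, p ∣ n := by
    intro n hn
    have hnc : ¬ n.Coprime r := (Finset.mem_filter.1 hn).2
    have hg : n.gcd r ≠ 1 := hnc
    refine ⟨(n.gcd r).minFac, ?_, (Nat.minFac_dvd _).trans (Nat.gcd_dvd_left n r)⟩
    rw [Nat.mem_primeFactors]
    exact ⟨Nat.minFac_prime hg, (Nat.minFac_dvd _).trans (Nat.gcd_dvd_right n r), by omega⟩
  calc ∑ n ∈ S, Λ n
      ≤ ∑ n ∈ S, ∑ p ∈ r.primeFactors, (if p ∣ n then Λ n else 0) := by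
        refine Finset.sum_le_sum fun n hn => ?_
        obtain ⟨p, hp, hpn⟩ := hex n hn
        calc Λ n = ∑ p' ∈ ({p} : Finset ℕ), (if p' ∣ n then Λ n else 0) := by simp [hpn]
          _ ≤ ∑ p' ∈ r.primeFactors, (if p' ∣ n then Λ n else 0) :=
            Finset.sum_le_sum_of_subset_of_nonneg (Finset.singleton_subset_iff.2 hp) fun p' _ _ => by
              split_ifs
              · exact ArithmeticFunction.vonMangoldt_nonneg
              · exact le_rfl
    _ = ∑ p ∈ r.primeFactors, ∑ n ∈ S with p ∣ n, Λ n := by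
        rw [Finset.sum_comm]
        refine Finset.sum_congr rfl fun p _ => ?_
        exact (Finset.sum_filter (fun n => p ∣ n) (fun n => (Λ n : ℝ))).symm
    _ ≤ ∑ p ∈ r.primeFactors, ∑ n ∈ (Icc 1 y).filter (fun n => p ∣ n), Λ n := by
        refine Finset.sum_le_sum fun p _ => ?_
        refine Finset.sum_le_sum_of_subset_of_nonneg ?_ fun _ _ _ => ArithmeticFunction.vonMangoldt_nonneg
        intro n hn
        simp only [hS, Finset.mem_filter] at hn ⊢
        exact ⟨hn.1.1, hn.2⟩
    _ ≤ ∑ p ∈ r.primeFactors, Real.log y :=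
        Finset.sum_le_sum fun p hp => sum_vonMangoldt_filter_dvd_le_log (Nat.prime_of_mem_primeFactors hp) hy
    _ = (ω r : ℝ) * Real.log y := by
        rw [Finset.sum_const, nsmul_eq_mul, ArithmeticFunction.cardDistinctFactors_apply,
          ← List.card_toFinset, Nat.toFinset_factors]


/-! ### Bookkeeping: the two sums of the discrepancy of a piece -/

/-- Inserting the coprimality filter `(n, r) = 1` into a sum of `Λ` over `(m, m']` costs at most
`ω(r) log m'`. [folklore] -/
theorem sum_filter_sub_sum_filter_coprime {m m' r : ℕ} (hr : 1 ≤ r) (hm' : 1 ≤ m') (P : ℕ → Prop)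
    [DecidablePred P] :
    0 ≤ (∑ n ∈ (Ioc m m').filter P, Λ n) - ∑ n ∈ ((Ioc m m').filter P).filter (fun n => n.Coprime r), Λ n ∧
    (∑ n ∈ (Ioc m m').filter P, Λ n) - ∑ n ∈ ((Ioc m m').filter P).filter (fun n => n.Coprime r), Λ n ≤
      (ω r : ℝ) * Real.log m' := by
  have hsplit := Finset.sum_filter_add_sum_filter_not ((Ioc m m').filter P) (fun n => n.Coprime r)
    (fun n => (Λ n : ℝ))
  have heq : (∑ n ∈ (Ioc m m').filter P, Λ n) - ∑ n ∈ ((Ioc m m').filter P).filter (fun n => n.Coprime r), Λ n =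
      ∑ n ∈ ((Ioc m m').filter P).filter (fun n => ¬ n.Coprime r), Λ n := by
    rw [← hsplit]; ring
  rw [heq]
  refine ⟨Finset.sum_nonneg fun _ _ => ArithmeticFunction.vonMangoldt_nonneg, ?_⟩
  refine le_trans ?_ (sum_vonMangoldt_filter_not_coprime_le hr hm')
  refine Finset.sum_le_sum_of_subset_of_nonneg ?_ fun _ _ _ => ArithmeticFunction.vonMangoldt_nonneg
  intro n hn
  simp only [Finset.mem_filter, Finset.mem_Ioc, Finset.mem_Icc] at hn ⊢
  exact ⟨⟨by omega, hn.1.1.2⟩, hn.2⟩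

/-- `ψ(m') − ψ(m) = Σ_{m < n ≤ m'} Λ(n)` for natural `m ≤ m'` (`ψ = Chebyshev.psi`). [folklore] -/
theorem chebyshevPsi_natCast_sub {m m' : ℕ} (h : m ≤ m') :
    Chebyshev.psi m' - Chebyshev.psi m = ∑ n ∈ Ioc m m', Λ n := by
  unfold Chebyshev.psi
  rw [Nat.floor_natCast, Nat.floor_natCast, ← Finset.sum_Ioc_consecutive _ (Nat.zero_le m) h]
  ring

/-- `τ(q) ≤ τ(qr)` for `r ≥ 1`. [folklore] -/
theorem sigma_zero_le_sigma_zero_mul {q r : ℕ} (hr : 1 ≤ r) : σ 0 q ≤ σ 0 (q * r) := by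
  rcases Nat.eq_zero_or_pos q with rfl | hq
  · simp
  rw [ArithmeticFunction.sigma_zero_apply, ArithmeticFunction.sigma_zero_apply]
  exact Finset.card_le_card (Nat.divisors_subset_of_dvd (by positivity) (Dvd.intro r rfl))

/-- `ω(n) ≤ τ(n)`. [folklore] -/
theorem cardDistinctFactors_le_sigma_zero (n : ℕ) : ω n ≤ σ 0 n := by
  rw [ArithmeticFunction.cardDistinctFactors_apply, ← List.card_toFinset, Nat.toFinset_factors,
    ArithmeticFunction.sigma_zero_apply]
  exact Finset.card_le_card fun p hp => Nat.mem_divisors.2 ⟨Nat.dvd_of_mem_primeFactors hp, (Nat.mem_primeFactors.1 hp).2.2⟩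


/-! ### The Siegel–Walfisz hypothesis (2.4) of Claim 2.6 for the pieces of `Λ` -/

set_option maxHeartbeats 1600000 in
-- one long explicit-constant estimate (two cases, a dozen auxiliary inequalities); about 4× the default budget
open Filter in
/-- **Polymath 8b, Claim 2.6 (2.4) for `β = Λ · 1_{(m,m']}`** — the Siegel–Walfisz hypothesis of
`GeneralizedElliottHalberstam` for the von Mangoldt pieces used in Proposition 2.7 ("the claim now
follows from the hypothesis `GEH[ϑ]`, thanks to the Siegel–Walfisz theorem", pp. 7 and 17).  Let
`m(x) ≤ m'(x) ≤ K m(x)` be natural scales with `m(x) ≥ x^{c₀}` and `m'(x) ≤ x` (eventually).  Then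
for every `B > 0` there is `C` with, eventually in `x`, for ALL `q, r ≥ 1` and primitive `a (q)`:
`|Δ((Λ 1_{(m,m']}) 1_{(·,r)=1}; a (q))| ≤ C τ(qr)^k m / log^B x` (`k ≥ 1`), with the cut-off `⌊K m⌋`
of `GeneralizedElliottHalberstam`.  Proof: for `q ≤ (log m)^{2B+2}` the Siegel–Walfisz theorem
(`siegel_walfisz_holds`) at `m` and `m'` and the prime number theorem with error term
(`chebyshevPsi_sub_self_isBigO_div_logPow`) for the coprime mean; for larger `q` the trivial bounds
`ψ(y; q, a) ≤ log y (y/q + 1)`, `ψ(y) ≪ y`, `√q ≪ φ(q)`; the coprimality filters cost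
`O((ω(q) + ω(r)) log x)` (`sum_filter_sub_sum_filter_coprime`). [cite: Polymath8b2014, Claim 2.6 (2.4) and Proposition 2.7] -/
theorem vonMangoldtPiece_siegelWalfisz_hypothesis {c₀ : ℝ} (hc₀ : 0 < c₀) (K : ℝ) (hK : 1 ≤ K)
    (m m' : ℝ → ℕ) (hm : ∀ᶠ x in atTop, x ^ c₀ ≤ m x) (hmm' : ∀ x, m x ≤ m' x)
    (hm'K : ∀ x, (m' x : ℝ) ≤ K * m x) (hm'x : ∀ᶠ x in atTop, (m' x : ℝ) ≤ x) (k : ℕ) (hk : 1 ≤ k)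
    (B : ℝ) (hB : 0 < B) :
    ∃ C : ℝ, ∀ᶠ x in atTop, ∀ q r : ℕ, 1 ≤ q → 1 ≤ r → ∀ a : (ZMod q)ˣ,
      |apDiscrepancy (fun n => if n.Coprime r then vonMangoldtPiece (m x) (m' x) n else 0) ⌊K * (m x : ℝ)⌋₊ q a|
        ≤ C * (σ 0 (q * r) : ℝ) ^ k * m x / Real.log x ^ B := by
  -- constants
  set B' : ℝ := 2 * (B + 1) with hB'
  have hB'0 : 0 < B' := by rw [hB']; linarith
  obtain ⟨C₁, hC₁⟩ := Literature.NumberTheory.LFunctions.siegel_walfisz_holds B' hB'0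
  obtain ⟨C₂, hC₂⟩ := (Literature.NumberTheory.LFunctions.PsiLogPower.chebyshevPsi_sub_self_isBigO_div_logPow B').bound
  obtain ⟨y₀, hy₀⟩ := Filter.eventually_atTop.1 hC₂
  obtain ⟨C₃, hC₃1, hC₃⟩ := Literature.NumberTheory.LFunctions.PagePNT.exists_sqrt_le_mul_totient
  -- the constant
  refine ⟨2 * (|C₁| + |C₂|) * K / c₀ ^ B' + (K / c₀ ^ B' + 1 + (Real.log 4 + 4) * K * C₃ / c₀ ^ (B + 1)) + 3, ?_⟩
  have hK0 : (0 : ℝ) ≤ K := by linarith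
  have hC₃0 : 0 ≤ C₃ := by linarith
  -- eventual conditions on `x`
  have e3 : ∀ᶠ x : ℝ in atTop, max 2 y₀ ≤ x ^ c₀ := (tendsto_rpow_atTop hc₀).eventually_ge_atTop _
  have e4 : ∀ᶠ x : ℝ in atTop, Real.log x ^ (B + 1) ≤ x ^ c₀ := by
    have := (isLittleO_log_rpow_rpow_atTop (B + 1) hc₀).bound (by norm_num : (0:ℝ) < 1)
    filter_upwards [this, eventually_gt_atTop (1 : ℝ)] with x hx hx1
    rw [one_mul, Real.norm_eq_abs, Real.norm_eq_abs, abs_of_nonneg (Real.rpow_nonneg (Real.log_nonneg hx1.le) _),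
      abs_of_nonneg (Real.rpow_nonneg (by linarith) _)] at hx
    exact hx
  have e5 : ∀ᶠ x : ℝ in atTop, Real.exp 1 ≤ x := eventually_ge_atTop _
  filter_upwards [hm, hm'x, e3, e4, e5] with x hmx hm'x hx3 hx4 hx5 q r hq hr a
  -- basic facts at this `x`
  have hx1 : 1 < x := lt_of_lt_of_le (by have := Real.add_one_le_exp (1:ℝ); linarith) hx5
  have hx0 : 0 < x := by linarith
  have hlogx : 1 ≤ Real.log x := by rwa [Real.le_log_iff_exp_le hx0]
  have hlogx0 : 0 < Real.log x := by linarith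
  have hm2 : (2 : ℝ) ≤ m x := le_trans (le_trans (le_max_left _ _) hx3) hmx
  have hmy₀ : y₀ ≤ (m x : ℝ) := le_trans (le_trans (le_max_right _ _) hx3) hmx
  have hm1 : (1 : ℝ) ≤ m x := by linarith
  have hm1n : 1 ≤ m x := by exact_mod_cast hm1
  have hmm'x := hmm' x
  have hm'1n : 1 ≤ m' x := le_trans hm1n hmm'x
  have hm'1 : (1 : ℝ) ≤ m' x := by exact_mod_cast hm'1n
  have hm'2 : (2 : ℝ) ≤ m' x := le_trans hm2 (by exact_mod_cast hmm'x)
  have hm'y₀ : y₀ ≤ (m' x : ℝ) := le_trans hmy₀ (by exact_mod_cast hmm'x)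
  have hmpos : (0 : ℝ) < m x := by linarith
  -- `log m ≥ c₀ log x`
  have hlogm : c₀ * Real.log x ≤ Real.log (m x) := by
    have h1 : Real.log (x ^ c₀) = c₀ * Real.log x := Real.log_rpow hx0 c₀
    rw [← h1]
    exact Real.log_le_log (Real.rpow_pos_of_pos hx0 _) hmx
  have hlogm' : c₀ * Real.log x ≤ Real.log (m' x) :=
    hlogm.trans (Real.log_le_log hmpos (by exact_mod_cast hmm'x))
  have hlogm'x : Real.log (m' x) ≤ Real.log x := Real.log_le_log (by linarith) hm'x
  have hc₀log : 0 < c₀ * Real.log x := mul_pos hc₀ hlogx0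
  -- `τ(qr) ≥ 1`, `ω ≤ τ`
  have hq0 : q ≠ 0 := by omega
  have hqr0 : q * r ≠ 0 := Nat.mul_ne_zero hq0 (by omega)
  have hτ1 : (1 : ℝ) ≤ (σ 0 (q * r) : ℝ) := by
    have : 1 ≤ σ 0 (q * r) := by
      rw [ArithmeticFunction.sigma_zero_apply]
      exact Finset.card_pos.2 ⟨1, Nat.one_mem_divisors.2 hqr0⟩
    exact_mod_cast this
  have hτk : (σ 0 (q * r) : ℝ) ≤ (σ 0 (q * r) : ℝ) ^ k := le_self_pow₀ hτ1 (by omega)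
  have hωr : (ω r : ℝ) ≤ (σ 0 (q * r) : ℝ) := by
    have h1 : ω r ≤ σ 0 r := cardDistinctFactors_le_sigma_zero r
    have h2 : σ 0 r ≤ σ 0 (r * q) := sigma_zero_le_sigma_zero_mul hq
    rw [mul_comm] at h2
    exact_mod_cast h1.trans h2
  have hωq : (ω q : ℝ) ≤ (σ 0 (q * r) : ℝ) := by
    exact_mod_cast (cardDistinctFactors_le_sigma_zero q).trans (sigma_zero_le_sigma_zero_mul hr)
  -- the cut-off covers the piece
  have hN : m' x ≤ ⌊K * (m x : ℝ)⌋₊ := Nat.le_floor (hm'K x)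
  -- the two sums of the discrepancy
  haveI : NeZero q := ⟨hq0⟩
  obtain ⟨A1, hA1⟩ : ∃ v : ℝ, v = ∑ n ∈ (Icc 1 ⌊K * (m x : ℝ)⌋₊).filter (fun n : ℕ => (n : ZMod q) = a),
    (if n.Coprime r then vonMangoldtPiece (m x) (m' x) n else 0) := ⟨_, rfl⟩
  obtain ⟨A2, hA2⟩ : ∃ v : ℝ, v = ∑ n ∈ (Icc 1 ⌊K * (m x : ℝ)⌋₊).filter (fun n : ℕ => n.Coprime q),
    (if n.Coprime r then vonMangoldtPiece (m x) (m' x) n else 0) := ⟨_, rfl⟩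
  have hΔ : apDiscrepancy (fun n => if n.Coprime r then vonMangoldtPiece (m x) (m' x) n else 0)
      ⌊K * (m x : ℝ)⌋₊ q a = A1 - A2 / Nat.totient q := by
    rw [hA1, hA2]; rfl
  obtain ⟨P1, hP1⟩ : ∃ v : ℝ, v = ∑ n ∈ (Ioc (m x) (m' x)).filter (fun n : ℕ => (n : ZMod q) = a), Λ n :=
    ⟨_, rfl⟩
  obtain ⟨P2, hP2⟩ : ∃ v : ℝ, v = ∑ n ∈ Ioc (m x) (m' x), Λ n := ⟨_, rfl⟩
  obtain ⟨P2q, hP2q⟩ : ∃ v : ℝ, v = ∑ n ∈ (Ioc (m x) (m' x)).filter (fun n : ℕ => n.Coprime q), Λ n :=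
    ⟨_, rfl⟩
  have hA1' : A1 = ∑ n ∈ ((Ioc (m x) (m' x)).filter (fun n : ℕ => (n : ZMod q) = a)).filter
      (fun n => n.Coprime r), Λ n := by
    rw [hA1, ← Finset.sum_filter, Finset.filter_filter, sum_filter_vonMangoldtPiece hN, Finset.filter_filter]
  have hA2' : A2 = ∑ n ∈ ((Ioc (m x) (m' x)).filter (fun n : ℕ => n.Coprime q)).filter
      (fun n => n.Coprime r), Λ n := by
    rw [hA2, ← Finset.sum_filter, Finset.filter_filter, sum_filter_vonMangoldtPiece hN, Finset.filter_filter]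
  obtain ⟨d1lo, d1hi⟩ := sum_filter_sub_sum_filter_coprime (m := m x) hr hm'1n (fun n : ℕ => (n : ZMod q) = a)
  rw [← hA1', ← hP1] at d1lo d1hi
  obtain ⟨d2lo, d2hi⟩ := sum_filter_sub_sum_filter_coprime (m := m x) hr hm'1n (fun n : ℕ => n.Coprime q)
  rw [← hA2', ← hP2q] at d2lo d2hi
  -- `P2 - P2q` : the coprimality to `q`
  have d3 : 0 ≤ P2 - P2q ∧ P2 - P2q ≤ (ω q : ℝ) * Real.log (m' x) := by
    have hsplit := Finset.sum_filter_add_sum_filter_not (Ioc (m x) (m' x)) (fun n : ℕ => n.Coprime q)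
      (fun n => (Λ n : ℝ))
    have heq : P2 - P2q = ∑ n ∈ (Ioc (m x) (m' x)).filter (fun n : ℕ => ¬ n.Coprime q), Λ n := by
      rw [hP2, hP2q, ← hsplit]; ring
    rw [heq]
    refine ⟨Finset.sum_nonneg fun _ _ => ArithmeticFunction.vonMangoldt_nonneg, ?_⟩
    refine le_trans ?_ (sum_vonMangoldt_filter_not_coprime_le hq hm'1n)
    refine Finset.sum_le_sum_of_subset_of_nonneg ?_ fun _ _ _ => ArithmeticFunction.vonMangoldt_nonneg
    intro n hn
    simp only [Finset.mem_filter, Finset.mem_Ioc, Finset.mem_Icc] at hn ⊢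
    exact ⟨⟨by omega, hn.1.2⟩, hn.2⟩
  -- `P1`, `P2` through `ψ`
  have hP1ψ : P1 = LevelOfDistribution.chebyshevPsiMod q a (m' x) - LevelOfDistribution.chebyshevPsiMod q a (m x) := by
    rw [hP1, chebyshevPsiMod_natCast_sub (a : ZMod q) hmm'x]
  have hP2ψ : P2 = Chebyshev.psi (m' x) - Chebyshev.psi (m x) := by
    rw [hP2, chebyshevPsi_natCast_sub hmm'x]
  -- the small terms: `3 τ log x ≤ 3 τ^k m / log^B x`
  have hφ1 : (1 : ℝ) ≤ Nat.totient q := by exact_mod_cast Nat.totient_pos.2 (by omega)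
  have hφ0 : (0 : ℝ) < Nat.totient q := by linarith
  have hlogm'0 : 0 ≤ Real.log (m' x) := Real.log_nonneg hm'1
  have hsmall : (ω r : ℝ) * Real.log (m' x) + ((ω q : ℝ) * Real.log (m' x) + (ω r : ℝ) * Real.log (m' x)) / Nat.totient q
      ≤ 3 * ((σ 0 (q * r) : ℝ) ^ k * m x / Real.log x ^ B) := by
    have t1 : (ω r : ℝ) * Real.log (m' x) ≤ (σ 0 (q * r) : ℝ) ^ k * Real.log x :=
      mul_le_mul (hωr.trans hτk) hlogm'x hlogm'0 (by positivity)
    have t2 : (ω q : ℝ) * Real.log (m' x) ≤ (σ 0 (q * r) : ℝ) ^ k * Real.log x :=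
      mul_le_mul (hωq.trans hτk) hlogm'x hlogm'0 (by positivity)
    have t3 : ((ω q : ℝ) * Real.log (m' x) + (ω r : ℝ) * Real.log (m' x)) / Nat.totient q ≤
        2 * ((σ 0 (q * r) : ℝ) ^ k * Real.log x) := by
      rw [div_le_iff₀ hφ0]
      have : 0 ≤ (σ 0 (q * r) : ℝ) ^ k * Real.log x := by positivity
      nlinarith
    -- `log x ≤ m / log^B x` from `log^{B+1} x ≤ x^{c₀} ≤ m`
    have key : Real.log x ≤ m x / Real.log x ^ B := by
      rw [le_div_iff₀ (Real.rpow_pos_of_pos hlogx0 B)]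
      have : Real.log x * Real.log x ^ B = Real.log x ^ (B + 1) := by
        rw [Real.rpow_add hlogx0, Real.rpow_one, mul_comm]
      rw [this]
      exact hx4.trans hmx
    have hτpos : 0 ≤ (σ 0 (q * r) : ℝ) ^ k := by positivity
    have := mul_le_mul_of_nonneg_left key hτpos
    rw [← mul_div_assoc] at this
    linarith
  -- the main term `P1 - P2/φ`
  set Y : ℝ := m x / Real.log x ^ B with hYdef
  have hY0 : 0 ≤ Y := by rw [hYdef]; positivity
  have hYX : Y ≤ (σ 0 (q * r) : ℝ) ^ k * m x / Real.log x ^ B := by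
    rw [hYdef, mul_div_assoc]
    exact le_mul_of_one_le_left (by positivity) (hτ1.trans hτk)
  -- rpow bookkeeping: `L₀ = c₀ log x`
  set L₀ : ℝ := c₀ * Real.log x with hL₀def
  have hL₀ : 0 < L₀ := hc₀log
  have hlogBpos : 0 < Real.log x ^ B := Real.rpow_pos_of_pos hlogx0 B
  have hlogB'pos : 0 < Real.log x ^ B' := Real.rpow_pos_of_pos hlogx0 B'
  have hlogB1pos : 0 < Real.log x ^ (B + 1) := Real.rpow_pos_of_pos hlogx0 _
  have hc₀B'pos : 0 < c₀ ^ B' := Real.rpow_pos_of_pos hc₀ _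
  have hc₀B1pos : 0 < c₀ ^ (B + 1) := Real.rpow_pos_of_pos hc₀ _
  have hL₀B' : L₀ ^ B' = c₀ ^ B' * Real.log x ^ B' := by rw [hL₀def, Real.mul_rpow hc₀.le hlogx0.le]
  have hL₀B1 : L₀ ^ (B + 1) = c₀ ^ (B + 1) * Real.log x ^ (B + 1) := by
    rw [hL₀def, Real.mul_rpow hc₀.le hlogx0.le]
  have hlogpowB1 : Real.log x * Real.log x ^ B = Real.log x ^ (B + 1) := by
    rw [Real.rpow_add hlogx0, Real.rpow_one, mul_comm]
  -- three basic comparisons with `Y = m / log^B x`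
  have AUX3 : m x / Real.log x ^ B' ≤ Y := by
    rw [hYdef]
    exact div_le_div_of_nonneg_left hmpos.le hlogBpos
      (Real.rpow_le_rpow_of_exponent_le hlogx (by rw [hB']; linarith))
  have AUX2 : m x / Real.log x ^ (B + 1) ≤ Y := by
    rw [hYdef]
    exact div_le_div_of_nonneg_left hmpos.le hlogBpos (Real.rpow_le_rpow_of_exponent_le hlogx (by linarith))
  have AUX1 : m x * Real.log x / Real.log x ^ B' ≤ Y := by
    have h1 : m x * Real.log x / Real.log x ^ B' ≤ m x * Real.log x / Real.log x ^ (B + 1) :=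
      div_le_div_of_nonneg_left (by positivity) hlogB1pos
        (Real.rpow_le_rpow_of_exponent_le hlogx (by rw [hB']; linarith))
    have h2 : m x * Real.log x / Real.log x ^ (B + 1) = Y := by
      rw [hYdef, ← hlogpowB1]
      field_simp
    linarith
  -- `y / log^{B'} y ≤ (K / c₀^{B'}) Y` for `y ≤ K m` with `log y ≥ L₀`
  have hfrac : ∀ y : ℝ, 0 ≤ y → y ≤ K * m x → L₀ ≤ Real.log y → y / Real.log y ^ B' ≤ K / c₀ ^ B' * Y := by
    intro y hy0 hyK hyL
    have hpow : L₀ ^ B' ≤ Real.log y ^ B' := Real.rpow_le_rpow hL₀.le hyL hB'0.le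
    have hL₀B'pos : 0 < L₀ ^ B' := Real.rpow_pos_of_pos hL₀ B'
    calc y / Real.log y ^ B' ≤ y / L₀ ^ B' := div_le_div_of_nonneg_left hy0 hL₀B'pos hpow
      _ ≤ K * m x / L₀ ^ B' := div_le_div_of_nonneg_right hyK hL₀B'pos.le
      _ = K / c₀ ^ B' * (m x / Real.log x ^ B') := by rw [hL₀B']; field_simp
      _ ≤ K / c₀ ^ B' * Y := mul_le_mul_of_nonneg_left AUX3 (div_nonneg hK0 hc₀B'pos.le)
  have hm'Km : (m' x : ℝ) ≤ K * m x := hm'K x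
  have hmKm : (m x : ℝ) ≤ K * m x := le_mul_of_one_le_left hmpos.le hK
  have hlog4 : 0 < Real.log 4 + 4 := by have := Real.log_pos (show (1:ℝ) < 4 by norm_num); linarith
  have hCm0 : 0 ≤ 2 * (|C₁| + |C₂|) * K / c₀ ^ B' + (K / c₀ ^ B' + 1 + (Real.log 4 + 4) * K * C₃ / c₀ ^ (B + 1)) := by
    have h1 : 0 ≤ 2 * (|C₁| + |C₂|) * K / c₀ ^ B' :=
      div_nonneg (mul_nonneg (mul_nonneg (by norm_num) (by positivity)) hK0) hc₀B'pos.le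
    have h2 : 0 ≤ K / c₀ ^ B' := div_nonneg hK0 hc₀B'pos.le
    have h3 : 0 ≤ (Real.log 4 + 4) * K * C₃ / c₀ ^ (B + 1) :=
      div_nonneg (mul_nonneg (mul_nonneg hlog4.le hK0) hC₃0) hc₀B1pos.le
    linarith
  have hmain : |P1 - P2 / Nat.totient q| ≤
      (2 * (|C₁| + |C₂|) * K / c₀ ^ B' + (K / c₀ ^ B' + 1 + (Real.log 4 + 4) * K * C₃ / c₀ ^ (B + 1))) * Y := by
    by_cases hqs : (q : ℝ) ≤ Real.log (m x) ^ B'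
    · -- small moduli: Siegel–Walfisz at `m`, `m'` and the prime number theorem
      have hqs' : (q : ℝ) ≤ Real.log (m' x) ^ B' :=
        hqs.trans (Real.rpow_le_rpow (Real.log_nonneg hm1) (Real.log_le_log hmpos (by exact_mod_cast hmm'x)) hB'0.le)
      have s1 : |LevelOfDistribution.chebyshevPsiMod q a (m' x) - (m' x : ℝ) / Nat.totient q| ≤
          C₁ * (m' x : ℝ) / Real.log (m' x) ^ B' := hC₁ _ hm'2 q hq hqs' a
      have s2 : |LevelOfDistribution.chebyshevPsiMod q a (m x) - (m x : ℝ) / Nat.totient q| ≤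
          C₁ * (m x : ℝ) / Real.log (m x) ^ B' := hC₁ _ hm2 q hq hqs a
      have p1 := hy₀ _ hm'y₀
      have p2 := hy₀ _ hmy₀
      rw [Real.norm_eq_abs, Real.norm_eq_abs] at p1 p2
      have f1 := hfrac (m' x) (by linarith) hm'Km hlogm'
      have f2 := hfrac (m x) hmpos.le hmKm hlogm
      have hpos1 : 0 ≤ (m' x : ℝ) / Real.log (m' x) ^ B' := by positivity
      have hpos2 : 0 ≤ (m x : ℝ) / Real.log (m x) ^ B' := by positivity
      rw [abs_of_nonneg hpos1] at p1
      rw [abs_of_nonneg hpos2] at p2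
      set u : ℝ := (m' x : ℝ) / Real.log (m' x) ^ B' with hu
      set v : ℝ := (m x : ℝ) / Real.log (m x) ^ B' with hv
      set S1 : ℝ := LevelOfDistribution.chebyshevPsiMod q a (m' x) - (m' x : ℝ) / Nat.totient q with hS1
      set S2 : ℝ := LevelOfDistribution.chebyshevPsiMod q a (m x) - (m x : ℝ) / Nat.totient q with hS2
      set T1 : ℝ := Chebyshev.psi (m' x) - m' x with hT1
      set T2 : ℝ := Chebyshev.psi (m x) - m x with hT2
      have s1' : |S1| ≤ |C₁| * u := by
        refine s1.trans ?_
        rw [mul_div_assoc]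
        exact mul_le_mul_of_nonneg_right (le_abs_self _) hpos1
      have s2' : |S2| ≤ |C₁| * v := by
        refine s2.trans ?_
        rw [mul_div_assoc]
        exact mul_le_mul_of_nonneg_right (le_abs_self _) hpos2
      have p1' : |T1| ≤ |C₂| * u := p1.trans (mul_le_mul_of_nonneg_right (le_abs_self _) hpos1)
      have p2' : |T2| ≤ |C₂| * v := p2.trans (mul_le_mul_of_nonneg_right (le_abs_self _) hpos2)
      have hdec : P1 - P2 / Nat.totient q = (S1 - S2) - (T1 - T2) / Nat.totient q := by
        rw [hP1ψ, hP2ψ, hS1, hS2, hT1, hT2]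
        field_simp
        ring
      rw [hdec]
      have hdivle : |(T1 - T2) / Nat.totient q| ≤ |C₂| * u + |C₂| * v := by
        rw [abs_div, abs_of_pos hφ0]
        refine (div_le_self (abs_nonneg _) hφ1).trans ?_
        exact (abs_sub _ _).trans (add_le_add p1' p2')
      have habs : |(S1 - S2) - (T1 - T2) / Nat.totient q| ≤ |C₁| * u + |C₁| * v + (|C₂| * u + |C₂| * v) := by
        have h1 := abs_sub (S1 - S2) ((T1 - T2) / Nat.totient q)
        have h2 := abs_sub S1 S2
        linarith
      refine habs.trans ?_
      have e : (|C₁| + |C₂|) * (u + v) = |C₁| * u + |C₁| * v + (|C₂| * u + |C₂| * v) := by ring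
      rw [← e]
      have hC12 : 0 ≤ |C₁| + |C₂| := by positivity
      calc (|C₁| + |C₂|) * (u + v) ≤ (|C₁| + |C₂|) * (K / c₀ ^ B' * Y + K / c₀ ^ B' * Y) :=
            mul_le_mul_of_nonneg_left (add_le_add f1 f2) hC12
        _ = 2 * (|C₁| + |C₂|) * K / c₀ ^ B' * Y := by ring
        _ ≤ _ := by
            have h2 : 0 ≤ K / c₀ ^ B' * Y := mul_nonneg (div_nonneg hK0 hc₀B'pos.le) hY0
            have h3 : 0 ≤ (Real.log 4 + 4) * K * C₃ / c₀ ^ (B + 1) * Y :=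
              mul_nonneg (div_nonneg (mul_nonneg (mul_nonneg hlog4.le hK0) hC₃0) hc₀B1pos.le) hY0
            have e : (2 * (|C₁| + |C₂|) * K / c₀ ^ B' + (K / c₀ ^ B' + 1 + (Real.log 4 + 4) * K * C₃ / c₀ ^ (B + 1))) * Y =
                2 * (|C₁| + |C₂|) * K / c₀ ^ B' * Y + (K / c₀ ^ B' * Y + Y + (Real.log 4 + 4) * K * C₃ / c₀ ^ (B + 1) * Y) := by
              ring
            rw [e]
            linarith
    · -- large moduli: trivial bounds
      rw [not_le] at hqs
      have hL₀B'pos : 0 < L₀ ^ B' := Real.rpow_pos_of_pos hL₀ B'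
      have hqL : L₀ ^ B' < q := lt_of_le_of_lt (Real.rpow_le_rpow hL₀.le hlogm hB'0.le) hqs
      have hqpos : (0 : ℝ) < q := by exact_mod_cast Nat.pos_of_ne_zero hq0
      -- `P1 ≤ ψ(m'; q, a) ≤ log m' (m'/q + 1)`
      have hP1le : P1 ≤ Real.log (m' x) * ((m' x : ℝ) / q) + Real.log (m' x) := by
        rw [hP1ψ]
        have h1 := BFI.chebyshevPsiMod_le_log_mul hq (a : ZMod q) hm'1
        have h2 : 0 ≤ LevelOfDistribution.chebyshevPsiMod q a (m x) :=
          Finset.sum_nonneg fun n _ => ArithmeticFunction.vonMangoldt.residueClass_nonneg (a : ZMod q) n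
        rw [mul_add, mul_one] at h1
        linarith
      have hP1nn : 0 ≤ P1 := by rw [hP1]; exact Finset.sum_nonneg fun _ _ => ArithmeticFunction.vonMangoldt_nonneg
      have hP2nn : 0 ≤ P2 := by rw [hP2]; exact Finset.sum_nonneg fun _ _ => ArithmeticFunction.vonMangoldt_nonneg
      have hP2le : P2 ≤ (Real.log 4 + 4) * m' x := by
        rw [hP2ψ]
        have := Chebyshev.psi_le_const_mul_self (show (0 : ℝ) ≤ m' x by linarith)
        linarith [Chebyshev.psi_nonneg (m x : ℝ)]
      have hsqrt : Real.sqrt q ≤ C₃ * Nat.totient q := hC₃ q hq0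
      have hsqrtpos : 0 < Real.sqrt q := Real.sqrt_pos.2 hqpos
      have hC₃0 : 0 ≤ C₃ := by linarith
      -- `√q ≥ L₀^{B+1}`
      have hsqrtq : L₀ ^ (B + 1) ≤ Real.sqrt q := by
        have e : L₀ ^ (B + 1) = Real.sqrt (L₀ ^ B') := by
          rw [Real.sqrt_eq_rpow, ← Real.rpow_mul hL₀.le, hB']
          congr 1
          ring
        rw [e]
        exact Real.sqrt_le_sqrt hqL.le
      have hL₀B1pos : 0 < L₀ ^ (B + 1) := Real.rpow_pos_of_pos hL₀ _
      -- term 1: `log m' · m'/q ≤ (K / c₀^{B'}) Y`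
      have t1 : Real.log (m' x) * ((m' x : ℝ) / q) ≤ K / c₀ ^ B' * Y := by
        have a1 : (m' x : ℝ) / q ≤ K * m x / L₀ ^ B' := by
          calc (m' x : ℝ) / q ≤ (m' x : ℝ) / L₀ ^ B' := div_le_div_of_nonneg_left (by linarith) hL₀B'pos hqL.le
            _ ≤ K * m x / L₀ ^ B' := div_le_div_of_nonneg_right hm'Km hL₀B'pos.le
        have a2 : Real.log (m' x) * (K * m x / L₀ ^ B') ≤ Real.log x * (K * m x / L₀ ^ B') :=
          mul_le_mul_of_nonneg_right hlogm'x (div_nonneg (mul_nonneg hK0 hmpos.le) hL₀B'pos.le)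
        have a3 : Real.log x * (K * m x / L₀ ^ B') = K / c₀ ^ B' * (m x * Real.log x / Real.log x ^ B') := by
          rw [hL₀B']; field_simp
        have a4 : K / c₀ ^ B' * (m x * Real.log x / Real.log x ^ B') ≤ K / c₀ ^ B' * Y :=
          mul_le_mul_of_nonneg_left AUX1 (div_nonneg hK0 hc₀B'pos.le)
        calc Real.log (m' x) * ((m' x : ℝ) / q) ≤ Real.log (m' x) * (K * m x / L₀ ^ B') :=
              mul_le_mul_of_nonneg_left a1 hlogm'0
          _ ≤ _ := a2
          _ = _ := a3
          _ ≤ _ := a4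
      -- term 2: `log m' ≤ Y`
      have t2 : Real.log (m' x) ≤ Y := by
        rw [hYdef]
        refine hlogm'x.trans ?_
        rw [le_div_iff₀ hlogBpos, hlogpowB1]
        exact hx4.trans hmx
      -- term 3: `P2/φ ≤ ((log 4 + 4) K C₃ / c₀^{B+1}) Y`
      have t3 : P2 / Nat.totient q ≤ (Real.log 4 + 4) * K * C₃ / c₀ ^ (B + 1) * Y := by
        have hinvφ : 1 / (Nat.totient q : ℝ) ≤ C₃ / Real.sqrt q := by
          rw [div_le_div_iff₀ hφ0 hsqrtpos]
          linarith
        have b1 : P2 / Nat.totient q ≤ (Real.log 4 + 4) * (K * m x) * (C₃ / Real.sqrt q) := by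
          calc P2 / Nat.totient q = P2 * (1 / Nat.totient q) := by ring
            _ ≤ ((Real.log 4 + 4) * (K * m x)) * (C₃ / Real.sqrt q) :=
                mul_le_mul (hP2le.trans (mul_le_mul_of_nonneg_left hm'Km hlog4.le)) hinvφ (by positivity)
                  (mul_nonneg hlog4.le (mul_nonneg hK0 hmpos.le))
        have b2 : C₃ / Real.sqrt q ≤ C₃ / L₀ ^ (B + 1) := div_le_div_of_nonneg_left hC₃0 hL₀B1pos hsqrtq
        have b3 : (Real.log 4 + 4) * (K * m x) * (C₃ / L₀ ^ (B + 1)) =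
            (Real.log 4 + 4) * K * C₃ / c₀ ^ (B + 1) * (m x / Real.log x ^ (B + 1)) := by
          rw [hL₀B1]; field_simp
        have b4 : (Real.log 4 + 4) * K * C₃ / c₀ ^ (B + 1) * (m x / Real.log x ^ (B + 1)) ≤
            (Real.log 4 + 4) * K * C₃ / c₀ ^ (B + 1) * Y :=
          mul_le_mul_of_nonneg_left AUX2 (div_nonneg (mul_nonneg (mul_nonneg hlog4.le hK0) hC₃0) hc₀B1pos.le)
        calc P2 / Nat.totient q ≤ (Real.log 4 + 4) * (K * m x) * (C₃ / Real.sqrt q) := b1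
          _ ≤ (Real.log 4 + 4) * (K * m x) * (C₃ / L₀ ^ (B + 1)) :=
              mul_le_mul_of_nonneg_left b2 (mul_nonneg hlog4.le (mul_nonneg hK0 hmpos.le))
          _ = _ := b3
          _ ≤ _ := b4
      -- combine
      have hP2φnn : 0 ≤ P2 / Nat.totient q := div_nonneg hP2nn hφ0.le
      have habs : |P1 - P2 / Nat.totient q| ≤ P1 + P2 / Nat.totient q := by
        rw [abs_le]; constructor <;> linarith
      refine habs.trans ?_
      have e : (2 * (|C₁| + |C₂|) * K / c₀ ^ B' + (K / c₀ ^ B' + 1 + (Real.log 4 + 4) * K * C₃ / c₀ ^ (B + 1))) * Y =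
          2 * (|C₁| + |C₂|) * K / c₀ ^ B' * Y + (K / c₀ ^ B' * Y + Y + (Real.log 4 + 4) * K * C₃ / c₀ ^ (B + 1) * Y) := by
        ring
      rw [e]
      have hD₁0 : 0 ≤ 2 * (|C₁| + |C₂|) * K / c₀ ^ B' * Y :=
        mul_nonneg (div_nonneg (mul_nonneg (mul_nonneg (by norm_num) (by positivity)) hK0) hc₀B'pos.le) hY0
      linarith
  -- assemble
  rw [hΔ]
  have hdecomp : A1 - A2 / Nat.totient q =
      (P1 - P2 / Nat.totient q) - (P1 - A1) + ((P2 - P2q) + (P2q - A2)) / Nat.totient q := by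
    ring
  rw [hdecomp]
  set X : ℝ := (σ 0 (q * r) : ℝ) ^ k * m x / Real.log x ^ B with hXdef
  have hX : 0 ≤ X := by rw [hXdef]; positivity
  have step1 : |P1 - P2 / ↑q.totient - (P1 - A1) + (P2 - P2q + (P2q - A2)) / ↑q.totient| ≤
      |P1 - P2 / ↑q.totient| + |P1 - A1| + |(P2 - P2q + (P2q - A2)) / ↑q.totient| := by
    have h1 := abs_sub (P1 - P2 / ↑q.totient) (P1 - A1)
    have h2 := abs_add_le (P1 - P2 / ↑q.totient - (P1 - A1)) ((P2 - P2q + (P2q - A2)) / ↑q.totient)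
    linarith
  have step2 : |P1 - A1| + |(P2 - P2q + (P2q - A2)) / ↑q.totient| ≤ 3 * X := by
    rw [abs_of_nonneg d1lo, abs_of_nonneg (div_nonneg (by linarith) hφ0.le)]
    have h1 : (P2 - P2q + (P2q - A2)) / ↑q.totient ≤
        ((ω q : ℝ) * Real.log (m' x) + (ω r : ℝ) * Real.log (m' x)) / Nat.totient q :=
      div_le_div_of_nonneg_right (by linarith [d3.2]) hφ0.le
    linarith [hsmall]
  have step3 : |P1 - P2 / ↑q.totient| + 3 * X ≤
      (2 * (|C₁| + |C₂|) * K / c₀ ^ B' + (K / c₀ ^ B' + 1 + (Real.log 4 + 4) * K * C₃ / c₀ ^ (B + 1)) + 3) * X := by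
    have e : (2 * (|C₁| + |C₂|) * K / c₀ ^ B' + (K / c₀ ^ B' + 1 + (Real.log 4 + 4) * K * C₃ / c₀ ^ (B + 1)) + 3) * X =
        (2 * (|C₁| + |C₂|) * K / c₀ ^ B' + (K / c₀ ^ B' + 1 + (Real.log 4 + 4) * K * C₃ / c₀ ^ (B + 1))) * X + 3 * X := by
      ring
    rw [e]
    have hYX' : Y ≤ X := by rw [hXdef]; exact hYX
    have := mul_le_mul_of_nonneg_left hYX' hCm0
    linarith [hmain]
  calc _ ≤ |P1 - P2 / ↑q.totient| + |P1 - A1| + |(P2 - P2q + (P2q - A2)) / ↑q.totient| := step1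
    _ ≤ |P1 - P2 / ↑q.totient| + 3 * X := by linarith
    _ ≤ _ := step3
    _ = _ := by rw [hXdef]; ring

end Literature.NumberTheory.Sieve
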